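import Summits.Ventures.YMGap.RobustBall.CentreBlindAreaLaw
import Summits.Ventures.YMGap.RobustBall.PlaquetteMember
import Summits.Ventures.YMGap.RobustBall.LoopActivity
import HarnessLib

/-!
# RobustBall/CentreBlindMembers — named members of the twist-blind class OF ARBITRARY SIZE: the SU(2) mixed
# fundamental–adjoint action `β_W·Wilson + t·∑_p (Re tr U_p)²` and, for every `N`, the adjoint action
# `β·Wilson + t·∑_p |tr U_p|²`, ANY real `t`, with their area laws

HONEST FRAMING: venture file of the cell `pub-ymgap` (track Y2 ROBUST-BALL, seat ds-4 g7).  Strong-coupling lattice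
statements on finite tori, uniformly in `L`; nothing about the continuum limit or a Clay-sense mass gap.  WHAT THIS
IS: non-emptiness BEYOND EVERY BALL of the class on which `CentreBlindAreaLaw` proves the window-free area law — the
`SU(2)` mixed action with adjoint-type density `f_t(g) = t · (Re tr g)²` (`= t · |tr g|²` on `SU(2)`, the adjoint
character up to a constant) is twist-blind for EVERY `t ∈ ℝ` (`isTwistBlind_of_su2_mixedAction`), exists as a member
of rb-theory's carrier on every torus `L ≥ 3` (`exists_su2_mixedAction_member`, via ds-4 g5's `exists_plaquetteMember`
with the explicit loads `a₀ = 4|t|`, `λ = 4√2 |t|`), and therefore (`su2_mixedAction_wilsonLoop_le`) at tree coupling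
`|β| ≤ 1/12` (`β_W ≤ 1/6`) in `d = 4` obeys `|⟨W_{R×T}⟩_{β,W_t,L}| ≤ (4 c^T)^R`, `c = 12|β|`, for EVERY `t` — e.g.
`t = 10⁶`, far outside every finite-radius ball of §5.  (Bhanot–Creutz plane: the bound is uniform along the whole
`β_A`-axis at fixed small `β_W`; its `β_A → ∞` end is 4D `ℤ₂` gauge theory at coupling `β_W`.)  Every `N ≥ 2`: rb-theory's
adjoint witness density `adjointDensity N t = t(|tr|² − 1)/(N² − 1)` (`Targets.lean` (w2)) — its typed loads target
`AdjointLoadsTarget N` is DISCHARGED here (`adjointLoadsTarget_holds`: oscillation `≤ |t|N²/(N²−1)`, Lipschitz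
`≤ 2N√N|t|/(N²−1)` via `‖tr a − tr b‖ ≤ √N‖a − b‖_F`), the action is a twist-blind member of ANY size
(`exists_adjointAction_member`) with the area law `adjointAction_wilsonLoop_le` at `2(d−1)N|β| ≤ c ≤ 1`.
-/

noncomputable section

open Finset
open Literature.MathematicalPhysics.QuantumLattice (fundamentalRep)
open Literature.MathematicalPhysics.QuantumFieldTheory

namespace Summit.Ventures.YMGap.RobustBall

variable {d L : ℕ}

/-- The SU(2) mixed (fundamental–adjoint) plaquette density `f_t(g) = t · (Re tr g)²`. [folklore] -/
def su2MixedDensity (t : ℝ) (g : SUN 2) : ℝ := t * ((g : Matrix (Fin 2) (Fin 2) ℂ).trace.re) ^ 2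

/-- For `N = 2` the character `ψ` takes the values `±1`. [folklore] -/
theorem ψ_two_eq (a : ZMod 2) : ψ 2 a = 1 ∨ ψ 2 a = -1 :=
  sq_eq_one_iff.1 (ψ_pow_card (N := 2) a)

/-- **The mixed density is twist invariant**: `f_t(ψ(a)·1·g) = f_t(g)` (`ψ(a) = ±1` on `ℤ/2`). [folklore] -/
theorem su2MixedDensity_centreOf_mul (t : ℝ) (a : ZMod 2) (g : SUN 2) :
    su2MixedDensity t (centreOf a * g) = su2MixedDensity t g := by
  unfold su2MixedDensity
  rw [trace_centreOf_mul]
  rcases ψ_two_eq a with h | h <;> rw [h] <;> simp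

/-- **Every SU(2) mixed plaquette action, of ANY size `t`, is twist-blind.** [folklore] -/
theorem isTwistBlind_of_su2_mixedAction [NeZero L] {t : ℝ} {W : Perturbation d L 2}
    (hW : IsPlaquetteAction (su2MixedDensity t) W) : IsTwistBlind W :=
  isTwistBlind_of_plaquetteAction hW (su2MixedDensity_centreOf_mul t)

/-! ### The member exists on every torus `L ≥ 3` (loads `a₀ = 4|t|`, `λ = 4√2·|t|`) -/

/-- `f_t` is continuous. [folklore] -/
theorem continuous_su2MixedDensity (t : ℝ) : Continuous (su2MixedDensity t) := by
  unfold su2MixedDensity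
  exact continuous_const.mul ((Complex.continuous_re.comp
    (Continuous.matrix_trace continuous_subtype_val)).pow 2)

/-- `f_t` is a class function. [folklore] -/
theorem su2MixedDensity_conj (t : ℝ) (g h : SUN 2) : su2MixedDensity t (h * g * h⁻¹) = su2MixedDensity t g := by
  unfold su2MixedDensity
  have htr : ((h * g * h⁻¹ : SUN 2) : Matrix (Fin 2) (Fin 2) ℂ).trace = (g : Matrix (Fin 2) (Fin 2) ℂ).trace := by
    rw [Submonoid.coe_mul, Submonoid.coe_mul, Matrix.trace_mul_cycle, ← Submonoid.coe_mul, inv_mul_cancel,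
      OneMemClass.coe_one, one_mul]
  rw [htr]

/-- `|Re tr g|² ≤ 4` on `SU(2)`. [folklore] -/
theorem sq_re_trace_su2_le (g : SUN 2) : ((g : Matrix (Fin 2) (Fin 2) ℂ).trace.re) ^ 2 ≤ 4 := by
  have h := abs_re_trace_su_le (N := 2) g
  have h' : |(g : Matrix (Fin 2) (Fin 2) ℂ).trace.re| ≤ 2 := by exact_mod_cast h
  nlinarith [abs_nonneg ((g : Matrix (Fin 2) (Fin 2) ℂ).trace.re), sq_abs ((g : Matrix (Fin 2) (Fin 2) ℂ).trace.re)]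

/-- Oscillation of `f_t`: `f_t x − f_t y ≤ 4|t|`. [folklore] -/
theorem su2MixedDensity_sub_le (t : ℝ) (x y : SUN 2) : su2MixedDensity t x - su2MixedDensity t y ≤ 4 * |t| := by
  unfold su2MixedDensity
  have hx := sq_re_trace_su2_le x
  have hy := sq_re_trace_su2_le y
  have h0x := sq_nonneg ((x : Matrix (Fin 2) (Fin 2) ℂ).trace.re)
  have h0y := sq_nonneg ((y : Matrix (Fin 2) (Fin 2) ℂ).trace.re)
  rw [← mul_sub]
  calc t * _ ≤ |t * (((x : Matrix (Fin 2) (Fin 2) ℂ).trace.re) ^ 2 - ((y : Matrix (Fin 2) (Fin 2) ℂ).trace.re) ^ 2)| :=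
        le_abs_self _
    _ = |t| * |((x : Matrix (Fin 2) (Fin 2) ℂ).trace.re) ^ 2 - ((y : Matrix (Fin 2) (Fin 2) ℂ).trace.re) ^ 2| :=
        abs_mul _ _
    _ ≤ |t| * 4 := mul_le_mul_of_nonneg_left (abs_le.2 ⟨by linarith, by linarith⟩) (abs_nonneg t)
    _ = 4 * |t| := mul_comm _ _

/-- Lipschitz bound of `f_t` for the Frobenius distance: `|f_t x − f_t y| ≤ 4√2·|t| · ‖x − y‖_F`. [folklore] -/
theorem abs_su2MixedDensity_sub_le (t : ℝ) (x y : SUN 2) :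
    |su2MixedDensity t x - su2MixedDensity t y| ≤ 4 * Real.sqrt 2 * |t| * suFrobDist x y := by
  unfold su2MixedDensity
  set a := (x : Matrix (Fin 2) (Fin 2) ℂ).trace.re
  set b := (y : Matrix (Fin 2) (Fin 2) ℂ).trace.re
  have hab : |a - b| ≤ Real.sqrt 2 * suFrobDist x y := by exact_mod_cast abs_re_trace_sub_le_suFrobDist (N := 2) x y
  have ha : |a| ≤ 2 := by exact_mod_cast abs_re_trace_su_le (N := 2) x
  have hb : |b| ≤ 2 := by exact_mod_cast abs_re_trace_su_le (N := 2) y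
  have hsum : |a + b| ≤ 4 := (abs_add_le _ _).trans (by linarith)
  rw [← mul_sub, abs_mul, show a ^ 2 - b ^ 2 = (a - b) * (a + b) by ring, abs_mul]
  calc |t| * (|a - b| * |a + b|) ≤ |t| * (Real.sqrt 2 * suFrobDist x y * 4) :=
        mul_le_mul_of_nonneg_left (mul_le_mul hab hsum (abs_nonneg _)
          (mul_nonneg (Real.sqrt_nonneg _) (suFrobDist_nonneg _ _))) (abs_nonneg t)
    _ = 4 * Real.sqrt 2 * |t| * suFrobDist x y := by ring

/-- **The SU(2) mixed action of ANY size exists as a member of rb-theory's carrier** on every torus `L ≥ 3`: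
`IsPlaquetteAction f_t W`, plaquette-local, in the tier-1 ball of radii `(2(d−1)·4|t|, 6d(d−1)·4√2|t|)`, and
TWIST-BLIND. [folklore] -/
theorem exists_su2_mixedAction_member (t : ℝ) (L : ℕ) [NeZero L] (hL : 3 ≤ L) :
    ∃ W : Perturbation d L 2, IsPlaquetteAction (su2MixedDensity t) W ∧ IsPlaquetteLocal W ∧ IsTwistBlind W := by
  obtain ⟨W, hact, hloc, -, -, -⟩ := exists_plaquetteMember 2 d (su2MixedDensity t) (4 * |t|) (4 * Real.sqrt 2 * |t|)
    (continuous_su2MixedDensity t) (su2MixedDensity_conj t) (su2MixedDensity_sub_le t) (by positivity)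
    (abs_su2MixedDensity_sub_le t) L hL
  exact ⟨W, hact, hloc, isTwistBlind_of_su2_mixedAction hact⟩

/-! ### The area law along the whole adjoint axis -/

/-- **Area law for the SU(2) mixed action of ANY size** (`d = 4`, tree `|β| ≤ 1/12`, i.e. `β_W ≤ 1/6`): every
perturbation with `IsPlaquetteAction f_t W` (any `t ∈ ℝ`), every torus, every non-wrapping `R × T` loop:
`|⟨W_{R×T}⟩_{β,W,L}| ≤ (4 (12|β|)^T)^R`. [folklore] -/
theorem su2_mixedAction_wilsonLoop_le [NeZero L] {β : ℝ} (hβ : |β| ≤ 1 / 12) {t : ℝ} (W : Perturbation 4 L 2)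
    (hW : IsPlaquetteAction (su2MixedDensity t) W) (x : Site 4 L) {i j : Fin 4} (hij : i ≠ j) {R T : ℕ}
    (hR : 2 * R ≤ L) (hT : 2 * T ≤ L) :
    |W.expectation (fundamentalRep (Fin 2)) β (wilsonLoop (fundamentalRep (Fin 2)) x i j R T)| ≤
      (4 * (12 * |β|) ^ T) ^ R :=
  abs_wilsonLoop_le_of_isTwistBlind (le_refl 2) (by push_cast; linarith [abs_nonneg β]) (by linarith)
    W (isTwistBlind_of_su2_mixedAction hW) x hij hR hT

/-! ### Every `N ≥ 2`: the adjoint plaquette action `t · ∑_p (|tr U_p|² − 1)/(N² − 1)` of ANY size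
(rb-theory's witness density `adjointDensity`, `Targets.lean` (w2); its loads target `AdjointLoadsTarget` is
discharged here) -/

/-- **The adjoint density is twist invariant for every `N`**: `|tr(ψ(a)·1·g)|² = |tr g|²`. [folklore] -/
theorem adjointDensity_centreOf_mul {N : ℕ} [NeZero N] (t : ℝ) (a : ZMod N) (g : SUN N) :
    adjointDensity N t (centreOf a * g) = adjointDensity N t g := by
  unfold adjointDensity; rw [normSq_trace_centreOf_mul]

/-- **Every SU(N) adjoint plaquette action, of ANY size `t`, is twist-blind.** [folklore] -/
theorem isTwistBlind_of_adjointAction {N : ℕ} [NeZero L] [NeZero N] {t : ℝ} {W : Perturbation d L N}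
    (hW : IsPlaquetteAction (adjointDensity N t) W) : IsTwistBlind W :=
  isTwistBlind_of_plaquetteAction hW (adjointDensity_centreOf_mul t)

/-- `‖tr a − tr b‖ ≤ √N ‖a − b‖_F` on `SU(N)` (Cauchy–Schwarz on the diagonal, via `Re(z̄·tr M) ≤ ‖z̄·1‖_F ‖M‖_F`). [folklore] -/
theorem norm_trace_sub_le_suFrobDist {N : ℕ} (a b : SUN N) :
    ‖(a : Matrix (Fin N) (Fin N) ℂ).trace - (b : Matrix (Fin N) (Fin N) ℂ).trace‖ ≤ Real.sqrt N * suFrobDist a b := by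
  set z := (a : Matrix (Fin N) (Fin N) ℂ).trace - (b : Matrix (Fin N) (Fin N) ℂ).trace with hz
  have h := abs_re_trace_mul_le ((starRingEnd ℂ z) • (1 : Matrix (Fin N) (Fin N) ℂ))
    ((a : Matrix (Fin N) (Fin N) ℂ) - (b : Matrix (Fin N) (Fin N) ℂ))
  rw [Matrix.smul_mul, one_mul, Matrix.trace_smul, smul_eq_mul, Matrix.trace_sub, ← hz, frobNorm_smul,
    Complex.norm_conj] at h
  have h1 : frobNorm (1 : Matrix (Fin N) (Fin N) ℂ) = Real.sqrt N := by simpa using frobNorm_su (1 : SUN N)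
  rw [h1] at h
  have hre : (starRingEnd ℂ z * z).re = ‖z‖ ^ 2 := by
    rw [Complex.conj_mul', ← Complex.ofReal_pow, Complex.ofReal_re]
  rw [hre, abs_of_nonneg (sq_nonneg _)] at h
  -- `‖z‖² ≤ ‖z‖ √N d` ⇒ `‖z‖ ≤ √N d`
  have hd : 0 ≤ Real.sqrt N * suFrobDist a b := mul_nonneg (Real.sqrt_nonneg _) (suFrobDist_nonneg _ _)
  rcases (norm_nonneg z).eq_or_lt with h0 | hpos
  · rw [← h0]; exact hd
  · have : ‖z‖ * ‖z‖ ≤ ‖z‖ * (Real.sqrt N * suFrobDist a b) := by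
      calc ‖z‖ * ‖z‖ = ‖z‖ ^ 2 := (sq _).symm
        _ ≤ ‖z‖ * Real.sqrt N * (suFrobDist a b) := by unfold suFrobDist; exact h
        _ = ‖z‖ * (Real.sqrt N * suFrobDist a b) := by ring
    exact le_of_mul_le_mul_left this hpos

/-- `|tr g|² ≤ N²` on `SU(N)`. [folklore] -/
theorem normSq_trace_su_le {N : ℕ} (g : SUN N) : Complex.normSq (g : Matrix (Fin N) (Fin N) ℂ).trace ≤ (N : ℝ) ^ 2 := by
  rw [Complex.normSq_eq_norm_sq]
  exact pow_le_pow_left₀ (norm_nonneg _) (norm_trace_le g) 2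

/-- `||tr x|² − |tr y|²| ≤ 2N√N ‖x − y‖_F` on `SU(N)`. [folklore] -/
theorem abs_normSq_trace_sub_le {N : ℕ} (x y : SUN N) :
    |Complex.normSq (x : Matrix (Fin N) (Fin N) ℂ).trace - Complex.normSq (y : Matrix (Fin N) (Fin N) ℂ).trace| ≤
      2 * N * Real.sqrt N * suFrobDist x y := by
  set a := (x : Matrix (Fin N) (Fin N) ℂ).trace
  set b := (y : Matrix (Fin N) (Fin N) ℂ).trace
  have ha : ‖a‖ ≤ N := norm_trace_le x
  have hb : ‖b‖ ≤ N := norm_trace_le y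
  have hab : ‖a - b‖ ≤ Real.sqrt N * suFrobDist x y := norm_trace_sub_le_suFrobDist x y
  rw [Complex.normSq_eq_norm_sq, Complex.normSq_eq_norm_sq, sq_sub_sq, abs_mul,
    abs_of_nonneg (add_nonneg (norm_nonneg a) (norm_nonneg b))]
  calc (‖a‖ + ‖b‖) * |‖a‖ - ‖b‖| ≤ (N + N) * (Real.sqrt N * suFrobDist x y) :=
        mul_le_mul (add_le_add ha hb) ((abs_norm_sub_norm_le a b).trans hab) (abs_nonneg _) (by positivity)
    _ = 2 * N * Real.sqrt N * suFrobDist x y := by ring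

/-- **`AdjointLoadsTarget N` holds** (rb-theory's typed target (w2), `Targets.lean`): for `N ≥ 2` the adjoint density
`f_t = t(|tr|² − 1)/(N² − 1)` is continuous, a class function, has oscillation `≤ |t|N²/(N² − 1)` and Frobenius-Lipschitz
constant `≤ 2N√N|t|/(N² − 1)`. [folklore] -/
theorem adjointLoadsTarget_holds (N : ℕ) : AdjointLoadsTarget N := by
  intro hN t
  have hN2 : (0 : ℝ) < (N : ℝ) ^ 2 - 1 := by
    have : (2 : ℝ) ≤ N := by exact_mod_cast hN
    nlinarith
  refine ⟨?_, ?_, ?_, ?_⟩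
  · unfold adjointDensity
    exact (continuous_const.mul ((Complex.continuous_normSq.comp
      (Continuous.matrix_trace continuous_subtype_val)).sub continuous_const)).div_const _
  · intro g h
    unfold adjointDensity
    have htr : ((h * g * h⁻¹ : SUN N) : Matrix (Fin N) (Fin N) ℂ).trace = (g : Matrix (Fin N) (Fin N) ℂ).trace := by
      rw [Submonoid.coe_mul, Submonoid.coe_mul, Matrix.trace_mul_cycle, ← Submonoid.coe_mul, inv_mul_cancel,
        OneMemClass.coe_one, one_mul]
    rw [htr]
  · intro x y
    unfold adjointDensity
    have hx := normSq_trace_su_le x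
    have hy := normSq_trace_su_le y
    have h0x := Complex.normSq_nonneg (x : Matrix (Fin N) (Fin N) ℂ).trace
    have h0y := Complex.normSq_nonneg (y : Matrix (Fin N) (Fin N) ℂ).trace
    rw [← sub_div, ← mul_sub, div_le_div_iff_of_pos_right hN2]
    have hdiff : |(Complex.normSq (x : Matrix (Fin N) (Fin N) ℂ).trace - 1) -
        (Complex.normSq (y : Matrix (Fin N) (Fin N) ℂ).trace - 1)| ≤ (N : ℝ) ^ 2 :=
      abs_le.2 ⟨by linarith, by linarith⟩
    calc t * _ ≤ |t * ((Complex.normSq (x : Matrix (Fin N) (Fin N) ℂ).trace - 1) -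
          (Complex.normSq (y : Matrix (Fin N) (Fin N) ℂ).trace - 1))| := le_abs_self _
      _ ≤ |t| * (N : ℝ) ^ 2 := by rw [abs_mul]; exact mul_le_mul_of_nonneg_left hdiff (abs_nonneg t)
  · intro x y
    unfold adjointDensity
    rw [← sub_div, ← mul_sub, abs_div, abs_of_pos hN2, abs_mul, div_mul_eq_mul_div, div_le_div_iff_of_pos_right hN2,
      show (Complex.normSq (x : Matrix (Fin N) (Fin N) ℂ).trace - 1) - (Complex.normSq (y : Matrix (Fin N) (Fin N) ℂ).trace - 1)
        = Complex.normSq (x : Matrix (Fin N) (Fin N) ℂ).trace - Complex.normSq (y : Matrix (Fin N) (Fin N) ℂ).trace by ring]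
    calc |t| * |Complex.normSq (x : Matrix (Fin N) (Fin N) ℂ).trace - Complex.normSq (y : Matrix (Fin N) (Fin N) ℂ).trace|
        ≤ |t| * (2 * N * Real.sqrt N * suFrobDist x y) := mul_le_mul_of_nonneg_left (abs_normSq_trace_sub_le x y) (abs_nonneg t)
      _ = 2 * N * Real.sqrt N * |t| * suFrobDist x y := by ring

/-- **The SU(N) adjoint action of ANY size exists as a TWIST-BLIND member of rb-theory's carrier** on every torus
`L ≥ 3` (`N ≥ 2`). [folklore] -/
theorem exists_adjointAction_member {N : ℕ} [NeZero N] (hN : 2 ≤ N) (t : ℝ) (L : ℕ) [NeZero L] (hL : 3 ≤ L) :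
    ∃ W : Perturbation d L N, IsPlaquetteAction (adjointDensity N t) W ∧ IsPlaquetteLocal W ∧ IsTwistBlind W := by
  obtain ⟨hc, hconj, hosc, hlip⟩ := adjointLoadsTarget_holds N hN t
  have hN2 : (0 : ℝ) < (N : ℝ) ^ 2 - 1 := by
    have : (2 : ℝ) ≤ N := by exact_mod_cast hN
    nlinarith
  obtain ⟨W, hact, hloc, -, -, -⟩ := exists_plaquetteMember N d (adjointDensity N t) _ _ hc hconj hosc
    (by positivity) hlip L hL
  exact ⟨W, hact, hloc, isTwistBlind_of_adjointAction hact⟩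

/-- **Area law along the whole adjoint axis, every `SU(N)`, `N ≥ 2`** (`c = 2(d−1)N|β| ≤ 1`): every perturbation
with `IsPlaquetteAction (adjointDensity N t) W`, ANY `t ∈ ℝ`, every torus, every non-wrapping loop:
`|⟨W_{R×T}⟩_{β,W,L}| ≤ (4 c^T)^R`. [folklore] -/
theorem adjointAction_wilsonLoop_le {N : ℕ} [NeZero L] [NeZero N] (hN : 2 ≤ N) {β c : ℝ}
    (hc : 2 * ((d - 1 : ℕ) : ℝ) * |β| * N ≤ c) (hc1 : c ≤ 1) {t : ℝ} (W : Perturbation d L N)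
    (hW : IsPlaquetteAction (adjointDensity N t) W) (x : Site d L) {i j : Fin d} (hij : i ≠ j) {R T : ℕ}
    (hR : 2 * R ≤ L) (hT : 2 * T ≤ L) :
    |W.expectation (fundamentalRep (Fin N)) β (wilsonLoop (fundamentalRep (Fin N)) x i j R T)| ≤ (4 * c ^ T) ^ R :=
  abs_wilsonLoop_le_of_isTwistBlind hN hc hc1 W (isTwistBlind_of_adjointAction hW) x hij hR hT

end Summit.Ventures.YMGap.RobustBall

end
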